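import Summits.QuantumFields.BalabanUV.Beta.RootedT2JetAdditive
import Summits.QuantumFields.BalabanUV.Beta.MixedWardSiteLaw
import Summits.QuantumFields.BalabanUV.Beta.RowD1MixedDischarged

/-!
# `BalabanUV.Beta.BorderWardSiteLaw` — binder row D1, «GAUGE-LETTERS» (G4-B): **an1's SITE-LEVEL BORDER WARD LAW (W2-B) IS A THEOREM;
# THE BORDER WARD BOND IDENTITY `hWb` AT lockB `cB = −Lc¹²∕4` IS DISCHARGED; hW ∧ hR AND THE ROW END FOR `JsRowD1Pin` NOW REST ON `hBb` ALONE**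
# (β sub-cell, BINDER-OWNERS row D1 OWNER, lineage an2 gen 21)

HONEST FRAMING (cell charter, verbatim): «discharging BetaPertH makes Balaban's UV stability UNCONDITIONAL — a real
constructive-QFT result; it is NOT the continuum limit and NOT the Clay problem.»
HONEST DEPENDENCY: continuum YM on T⁴ ⇐ BetaPertH ∧ nine spine estimates (0/9 proved); BetaPertH ⇐ (D1) ∧ (D4) ∧ CAP+tail;
G-an2-4 gates asym, D1 and NE2/3/4.
DERIVED cell leaf ([folklore] letter algebra and `4 × 4` word evaluation), BY NAME over G3 `BorderJetWard.T2At_gauge` (⟸ G1 `PhiGAt_gauge`),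
G3b `RootedT2JetAdditive` (`T2At_sum_B`, `T2At_sub_B`), G4-M `MixedWardSiteLaw` (`dInd_smul_eq_sum`, `rootComm_eq`, `comm_smul_right`, the entries,
`symmetries_JsRowD1Pin_of_borderLaws`), G4-M part 1 `βg1_single`, an3's 33M4 entries (`ent_X1_a`, `ent_X2_a`, `ent_X1_ap`, `ent_Xc_ap`,
`ite_entry`), node 7aρ `vhUAt_single`, node 12b (`vh2Tab`, `vh2KerAt`, `vhKerAt`, `T2At_symm`), leaf-05's WX5 `bondWardB_of_siteWardB` and RX-M4
`d1Drift_JsRowD1Pin_of_borderBondLaw_siteLaws_D1Tel_D1Rep`.  No statement of Bałaban's papers, no `[cite:]`, no `def`, no `Prop` fact.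
NOT D1, NOT `BetaPertH`, NOT continuum, NOT Clay.

WHAT (`r = L·y + ρ`; `n = vhCountAt ρ L μ y f h`; `c = (2L^{2d})⁻¹`; `χ_z = [u = z]`; `h₋ = x_h`, `h₊ = x_h + e_{κ_h}`):
* §1 `βfar_single`, `comm_smul_left`, one new `(0,3)` entry `ent_B2` (the other words are 33M4's `ent_X1_a/ent_X2_a/ent_X1_ap/ent_Xc_ap` and G4-M's `ent_W4_a`).
* §2 **THE TWO SINGLE-ASSIGNMENT SITE LAWS OF `vh2Tab`** (ℚ, general `d`, any root, `(L:ℚ) ≠ 0`): `vh2Tab_siteWard₁`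
  `Σ_κ (s(f;(κ,u−e_κ),h) − s(f;(κ,u),h)) = c·n·(2χ_r − χ_{h₊} − χ_{h₋})` (stencil letter `E₀₁`: only the spectator rotations and the root survive) and
  `vh2Tab_siteWard₂` `Σ_κ (s(f;h,(κ,u−e_κ)) − s(f;h,(κ,u))) = c·n·(χ_{h₊} + χ_{h₋} − 2χ_{x_f})` (stencil letter `E₁₂`: only the spectator and fluctuation
  rotations survive) — an1-g31's single-slot forms (journal 2026-08-20 l.18142) and num-g39 ENGINE-W2's, now theorems.
* §3 `vh2KerAt_siteWard` (ℝ) and **`siteWardB`** = WX5's `hSB` ∕ RX-M4's `hSB` VERBATIM at `d = 4`, root `ρ_c`: their ½-symmetrisation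
  `= vhKerAt·(χ_r − χ_{x_f})` — the border pin is DERIVED: `c·n = vhKerAt` is node 7aρ's normalisation, and WX5's bookkeeping turns it into lockB
  `cB = −Lc¹²∕4` (I-d1ref18-1).
* §4 DISCHARGES: `bondWardB` = WX4∕RX's `hWb` (WX5 `bondWardB_of_siteWardB`); **`symmetries_JsRowD1Pin_of_borderBondLaw (hLc) (hN) γ hγ (hBb) : hW ∧ hR`**
  and **`d1Drift_JsRowD1Pin_of_borderBondLaw_D1Tel_D1Rep`**: `D1Drift Lc (JsRowD1Pin hLc N) Nc μ ν` ⟸ `hBb` ∧ D1Tel ∧ D1Rep (+ the route's printed B5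
  facts, window, `μ ≠ ν`, `Nc ≠ 0`) — THREE of RX's four bond identities (hMb an3 33M4, hWM G4-M, hWb here) are theorems.
HONEST: the hW∕hR wall of row D1 for the literal of record is now EXACTLY the border reflection bond law `hBb` (an3 33I→33J→33K); `D1Tel`, `D1Rep`
untouched; 0∕4 binders discharged outright (hW and hR each still contain `hBb`).  NOT D1, NOT BetaPertH, NOT continuum, NOT Clay.
Provenance: β sub-cell, unit beta-an2 gen 21, 2026-08-20 (v1); no existing file touched.
-/

open Finset
open scoped BigOperators
open Literature.MathematicalPhysics.QuantumFieldTheory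
open Literature.MathematicalPhysics.QuantumFieldTheory.Balaban1983to89
open Literature.MathematicalPhysics.QuantumFieldTheory.Balaban1983to89.Beta
open AffineAveraging (Form1 Site box toSite)
open AveragingContours (blk off)
open AveragingContoursRooted (ctr ctrOff)
open AveragingHessianKernels (Bond single single_apply)
open AveragingHessianKernelsRooted (vhUAt vhCountAt vhUAt_single vhKerAt linKerAt hessKerAt)
open AveragingThirdJet (upF)
open AveragingMixedJetTables (T2At T2At_symm UT E vh2Tab vh2KerAt mixKerAt)
open ExpKernelCalculus (MKer)
open PolarizationSign (reflSign WardTransversal AxisReflectionCovariant)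
open ResolventReflection (bref)
open OneStepResolventKernel (Fib JetData)
open OneStepKernelFamily (TbalOf flipK D1Tel D1Rep D1Drift)
open Literature.MathematicalPhysics.QuantumFieldTheory.Balaban1983to89.Beta.VectorTailsLoc (fam kfam)
open Literature.MathematicalPhysics.QuantumFieldTheory.Balaban1983to89.Beta.VectorLegVolumeAdapter (MvE)
open BalabanStepJetsSucc (wVH)
open Summit.QuantumFields.BalabanUV.Beta.BorderedHessian (stepScale)
open Summit.QuantumFields.BalabanUV.Beta.RowD1JointEnd (JsRowD1Pin)
open Summit.QuantumFields.BalabanUV.Beta.MixedJetWard (βg1)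
open Summit.QuantumFields.BalabanUV.Beta.MixedJetWardSingle (βg1_single)
open Summit.QuantumFields.BalabanUV.Beta.RootedMixedTableLaw (ent_X1_a ent_X2_a ent_X1_ap ent_Xc_ap ite_entry)
open Summit.QuantumFields.BalabanUV.Beta.MixedWardSiteLaw (dInd_smul_eq_sum rootComm_eq comm_smul_right ent_W4_a siteWardM
  symmetries_JsRowD1Pin_of_borderLaws)
open Summit.QuantumFields.BalabanUV.Beta.BorderJetWard (βfar T2At_gauge)
open Summit.QuantumFields.BalabanUV.Beta.RootedT2JetAdditive (T2At_sum_B T2At_sub_B)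
open Summit.QuantumFields.BalabanUV.Beta.WardSiteToBlock (bondWardB_of_siteWardB)
open Summit.QuantumFields.BalabanUV.Beta.RowD1MixedDischarged (d1Drift_JsRowD1Pin_of_borderBondLaw_siteLaws_D1Tel_D1Rep)

namespace Summit.QuantumFields.BalabanUV.Beta.BorderWardSiteLaw

/-! ## §1 Letters and two entries -/

section Letters

variable {𝕜 : Type*} [Field 𝕜] {d : ℕ} {𝔸 : Type*} [Ring 𝔸] [Algebra 𝕜 𝔸]

/-- [folklore] `βfar(single F a) = single F (λ(x_F + e_{κ_F})•[D, a])` (rotation at the FAR end of the bond). -/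
theorem βfar_single (lam : (Fin d → ℤ) → 𝕜) (D : 𝔸) (F : Bond d) (a : 𝔸) :
    βfar lam D (single F a) = single F (lam (F.2 + AffineAveraging.unitVec F.1) • AveragingHessianKernels.comm D a) := by
  funext κ x
  simp only [βfar, single_apply]
  by_cases h : (κ, x) = F
  · rw [if_pos h, if_pos h, ← h, AveragingHessianKernels.comm, smul_mul_assoc, mul_smul_comm, smul_sub]
  · rw [if_neg h, if_neg h, mul_zero, zero_mul, sub_self]

/-- [folklore] `[s•a, b] = s•[a, b]`. -/
theorem comm_smul_left (s : 𝕜) (a b : 𝔸) : AveragingHessianKernels.comm (s • a) b = s • AveragingHessianKernels.comm a b := by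
  simp only [AveragingHessianKernels.comm, mul_smul_comm, smul_mul_assoc, smul_sub]

end Letters

section Entries

/-- [folklore] `[[E₁₂, E₂₃], E₀₁]₀₃ = −1` (the fluctuation-rotation word at the second assignment). -/
theorem ent_B2 : (AveragingHessianKernels.comm (AveragingHessianKernels.comm (E 1 2) (E 2 3)) (E 0 1)) 0 3 = -1 := by
  simp [AveragingHessianKernels.comm, E]

end Entries

/-! ## §2 The two single-assignment site laws of `vh2Tab` -/

section Tables

variable {d L : ℕ} (hL : (L : ℚ) ≠ 0)
include hL

open Classical in
/-- [folklore] **SITE LAW OF `vh2Tab`, STENCIL IN THE FIRST BACKGROUND** (letters: stencil `E₀₁`, spectator `E₁₂`, fluctuation `E₂₃`):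
`Σ_κ (s(f;(κ,u−e_κ),h) − s(f;(κ,u),h)) = (2L^{2d})⁻¹·n(f,h)·(2χ_r − χ_{h₊} − χ_{h₋})`. -/
theorem vh2Tab_siteWard₁ (ρ : Fin d → ℤ) (μ : Fin d) (y u : Fin d → ℤ) (f h : Bond d) :
    ∑ κ : Fin d, (vh2Tab ρ L μ y f (κ, u - AffineAveraging.unitVec κ) h - vh2Tab ρ L μ y f (κ, u) h)
      = ((2 : ℚ) * (L : ℚ) ^ (2 * d))⁻¹ * vhCountAt ρ L μ y f h
          * (2 * (if u = (L : ℤ) • y + ρ then (1 : ℚ) else 0)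
              - (if u = h.2 + AffineAveraging.unitVec h.1 then (1 : ℚ) else 0) - (if u = h.2 then (1 : ℚ) else 0)) := by
  have key := T2At_gauge (𝕜 := ℚ) (𝔸 := UT) (fun z : Site d => if u = z then (1 : ℚ) else 0) (E 0 1) hL two_ne_zero ρ
    (single f (E 2 3)) (single h (E 1 2)) μ y
  beta_reduce at key
  rw [dInd_smul_eq_sum, T2At_sum_B (h2 := two_ne_zero), βfar_single, βg1_single, βg1_single, vhUAt_single, vhUAt_single, vhUAt_single,
    vhUAt_single, comm_smul_right, comm_smul_right, comm_smul_left, rootComm_eq] at key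
  have k := congrFun (congrFun key 0) 3
  simp only [T2At_sub_B (h2 := two_ne_zero), Matrix.sum_apply, Matrix.sub_apply, Matrix.add_apply, Matrix.smul_apply, ent_W4_a, ent_Xc_ap,
    ent_X2_a] at k
  simp only [vh2Tab]
  rw [k]
  simp only [smul_eq_mul, zsmul_eq_mul, mul_zero, mul_neg, mul_one]
  ring

open Classical in
/-- [folklore] **SITE LAW OF `vh2Tab`, STENCIL IN THE SECOND BACKGROUND** (letters: spectator `E₀₁`, stencil `E₁₂`, fluctuation `E₂₃`):
`Σ_κ (s(f;h,(κ,u−e_κ)) − s(f;h,(κ,u))) = (2L^{2d})⁻¹·n(f,h)·(χ_{h₊} + χ_{h₋} − 2χ_{x_f})`. -/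
theorem vh2Tab_siteWard₂ (ρ : Fin d → ℤ) (μ : Fin d) (y u : Fin d → ℤ) (f h : Bond d) :
    ∑ κ : Fin d, (vh2Tab ρ L μ y f h (κ, u - AffineAveraging.unitVec κ) - vh2Tab ρ L μ y f h (κ, u))
      = ((2 : ℚ) * (L : ℚ) ^ (2 * d))⁻¹ * vhCountAt ρ L μ y f h
          * ((if u = h.2 + AffineAveraging.unitVec h.1 then (1 : ℚ) else 0) + (if u = h.2 then (1 : ℚ) else 0)
              - 2 * (if u = f.2 then (1 : ℚ) else 0)) := by
  have key := T2At_gauge (𝕜 := ℚ) (𝔸 := UT) (fun z : Site d => if u = z then (1 : ℚ) else 0) (E 1 2) hL two_ne_zero ρ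
    (single f (E 2 3)) (single h (E 0 1)) μ y
  beta_reduce at key
  rw [dInd_smul_eq_sum, T2At_sum_B (h2 := two_ne_zero), βfar_single, βg1_single, βg1_single, vhUAt_single, vhUAt_single, vhUAt_single,
    vhUAt_single, comm_smul_right, comm_smul_right, comm_smul_left, rootComm_eq] at key
  have k := congrFun (congrFun key 0) 3
  simp only [T2At_sub_B (h2 := two_ne_zero), Matrix.sum_apply, Matrix.sub_apply, Matrix.add_apply, Matrix.smul_apply, ent_X1_ap, ent_B2,
    ent_X1_a] at k
  have hs : ∀ g : Bond d, vh2Tab ρ L μ y f h g = T2At ℚ ρ (upF (single f (E 2 3))) (single g (E 1 2)) (single h (E 0 1)) L μ y 0 3 := by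
    intro g; rw [vh2Tab, T2At_symm]
  simp only [hs]
  rw [k]
  simp only [smul_eq_mul, zsmul_eq_mul, mul_zero, sub_zero, mul_neg, mul_one]
  ring

end Tables

/-! ## §3 (W2-B) in kernel currency -/

section Kernels

variable {d : ℕ}

open Classical in
/-- [folklore] **an1's SITE-LEVEL BORDER WARD LAW (W2-B) — A THEOREM** (general `d`, any root `ρ`, `L ≠ 0`): the ½-symmetrisation of the two
single-assignment laws is `m_b(f,h)·([u = r_b] − [u = x_f])`, `m_b = vhKerAt = n∕(2L^{2d})`. -/
theorem vh2KerAt_siteWard {L : ℕ} (hL : L ≠ 0) (ρ : Fin d → ℤ) (μ : Fin d) (y u : Fin d → ℤ) (f h : Bond d) :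
    ∑ κ : Fin d,
        ((1 / 2 : ℝ) * (vh2KerAt ρ L μ y f (κ, u - AffineAveraging.unitVec κ) h + vh2KerAt ρ L μ y f h (κ, u - AffineAveraging.unitVec κ))
          - (1 / 2 : ℝ) * (vh2KerAt ρ L μ y f (κ, u) h + vh2KerAt ρ L μ y f h (κ, u)))
      = vhKerAt ρ L μ y f h * ((if u = (L : ℤ) • y + ρ then (1 : ℝ) else 0) - (if u = f.2 then (1 : ℝ) else 0)) := by
  have hLq : (L : ℚ) ≠ 0 := Nat.cast_ne_zero.2 hL
  have h₁ := congrArg (fun q : ℚ => (q : ℝ)) (vh2Tab_siteWard₁ hLq ρ μ y u f h)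
  have h₂ := congrArg (fun q : ℚ => (q : ℝ)) (vh2Tab_siteWard₂ hLq ρ μ y u f h)
  simp only [Rat.cast_sum, Rat.cast_sub, Rat.cast_add, Rat.cast_mul, Rat.cast_inv, Rat.cast_pow, Rat.cast_natCast, Rat.cast_intCast,
    Rat.cast_ofNat, apply_ite (Rat.cast : ℚ → ℝ), Rat.cast_one, Rat.cast_zero] at h₁ h₂
  have hs : ∀ κ : Fin d,
      (1 / 2 : ℝ) * (vh2KerAt ρ L μ y f (κ, u - AffineAveraging.unitVec κ) h + vh2KerAt ρ L μ y f h (κ, u - AffineAveraging.unitVec κ))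
        - (1 / 2 : ℝ) * (vh2KerAt ρ L μ y f (κ, u) h + vh2KerAt ρ L μ y f h (κ, u))
      = (1 / 2 : ℝ) * ((vh2Tab ρ L μ y f (κ, u - AffineAveraging.unitVec κ) h : ℝ) - (vh2Tab ρ L μ y f (κ, u) h : ℝ))
        + (1 / 2 : ℝ) * ((vh2Tab ρ L μ y f h (κ, u - AffineAveraging.unitVec κ) : ℝ) - (vh2Tab ρ L μ y f h (κ, u) : ℝ)) := by
    intro κ; simp only [vh2KerAt]; ring
  rw [Finset.sum_congr rfl (fun κ _ => hs κ), Finset.sum_add_distrib, ← Finset.mul_sum, ← Finset.mul_sum, h₁, h₂, vhKerAt, div_eq_mul_inv]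
  ring

end Kernels

/-! ## §4 `d = 4`, root `ρ_c`: WX5's `hSB` verbatim, and the discharges -/

section Row

variable {Lc : ℕ} [NeZero Lc]

open Classical in
/-- [folklore] **(W2-B) AT `d = 4`, ROOT `ρ_c = toSite (ctrOff 4 Lc)`** — the hypothesis `hS` of WX5's `bondWardB_of_siteWardB` ∕ `hSB` of RX-M4, token
for token, now a theorem. -/
theorem siteWardB :
    ∀ (u : Fin 4 → ℤ) (m : Fin 4) (y : Fin 4 → ℤ) (β : Fin 4) (x : Fin 4 → ℤ) (κ' : Fin 4) (u' : Fin 4 → ℤ),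
      ∑ κ : Fin (3 + 1),
          ((1 / 2 : ℝ) * (vh2KerAt (toSite (ctrOff 4 Lc)) Lc m y (β, x) (κ, u - B6BondElimination.unitVec κ) (κ', u')
              + vh2KerAt (toSite (ctrOff 4 Lc)) Lc m y (β, x) (κ', u') (κ, u - B6BondElimination.unitVec κ))
            - (1 / 2 : ℝ) * (vh2KerAt (toSite (ctrOff 4 Lc)) Lc m y (β, x) (κ, u) (κ', u')
              + vh2KerAt (toSite (ctrOff 4 Lc)) Lc m y (β, x) (κ', u') (κ, u))) =
        vhKerAt (toSite (ctrOff 4 Lc)) Lc m y (β, x) (κ', u')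
          * ((if u = (Lc : ℤ) • y + toSite (ctrOff 4 Lc) then (1 : ℝ) else 0) - (if u = x then (1 : ℝ) else 0)) := by
  intro u m y β x κ' u'
  have hU : ∀ κ : Fin 4, (B6BondElimination.unitVec κ : Fin 4 → ℤ) = AffineAveraging.unitVec κ := fun κ => by
    funext i
    simp only [B6BondElimination.unitVec, AffineAveraging.unitVec, Pi.single_apply]
  simp only [hU]
  exact vh2KerAt_siteWard (NeZero.ne Lc) (toSite (ctrOff 4 Lc)) m y u (β, x) (κ', u')

/-- [folklore] **THE BORDER WARD BOND IDENTITY `hWb` AT lockB `cB = −Lc¹²∕4` — DISCHARGED** (WX4's `hW` ∕ RX's `hWb`, token for token; WX5's block sum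
`bondWardB_of_siteWardB` of `siteWardB`). -/
theorem bondWardB (hLc : Odd Lc) :
    ∀ (Y : Fin 4 → ℤ) (κ' : Fin 4) (u' x z : Fin 4 → ℤ) (β m : Fin 4), off Lc z = 0 →
      (stepScale 3 Lc 0 * (Lc : ℝ) ^ (3 + 1))⁻¹ *
          ∑ v ∈ box (3 + 1) Lc, ∑ κ : Fin (3 + 1),
            ((-((Lc : ℝ) ^ 12 / 4)) * ((1 / 2 : ℝ) * (vh2KerAt (toSite (ctrOff 4 Lc)) Lc m (blk Lc z) (β, x) (κ, (Lc : ℤ) • Y + toSite v - B6BondElimination.unitVec κ) (κ', u')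
                + vh2KerAt (toSite (ctrOff 4 Lc)) Lc m (blk Lc z) (β, x) (κ', u') (κ, (Lc : ℤ) • Y + toSite v - B6BondElimination.unitVec κ)))
              - (-((Lc : ℝ) ^ 12 / 4)) * ((1 / 2 : ℝ) * (vh2KerAt (toSite (ctrOff 4 Lc)) Lc m (blk Lc z) (β, x) (κ, (Lc : ℤ) • Y + toSite v) (κ', u')
                + vh2KerAt (toSite (ctrOff 4 Lc)) Lc m (blk Lc z) (β, x) (κ', u') (κ, (Lc : ℤ) • Y + toSite v)))) =
        (-((Lc : ℝ) ^ (3 + 1) * (1 / 2) * (Lc : ℝ) ^ (3 + 1))) * vhKerAt (toSite (ctrOff 4 Lc)) Lc m (blk Lc z) (β, x) (κ', u')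
            * ((1 / 2 : ℝ) * ∑ v ∈ box (3 + 1) Lc, (if z + toSite (ctrOff 4 Lc) = (Lc : ℤ) • Y + toSite v then (1 : ℝ) else 0))
          - ((1 / 2 : ℝ) * ∑ v ∈ box (3 + 1) Lc, (if x = (Lc : ℤ) • Y + toSite v then (1 : ℝ) else 0))
            * ((-((Lc : ℝ) ^ (3 + 1) * (1 / 2) * (Lc : ℝ) ^ (3 + 1))) * vhKerAt (toSite (ctrOff 4 Lc)) Lc m (blk Lc z) (β, x) (κ', u')) :=
  bondWardB_of_siteWardB hLc siteWardB

open Classical in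
/-- [folklore] **hW ∧ hR FOR THE LITERAL OF RECORD `JsRowD1Pin hLc N` FROM THE BORDER REFLECTION BOND LAW `hBb` ALONE** (G4-M's
`symmetries_JsRowD1Pin_of_borderLaws` with (W2-B) := `siteWardB`). -/
theorem symmetries_JsRowD1Pin_of_borderBondLaw (hLc : Odd Lc) {N : ℕ} (hN : 2 ≤ N) (γ : ℕ → ℝ)
    (hγ : ∀ j, γ j = -((Lc : ℝ) ^ 8 / 2) * wVH 3 Lc j / (stepScale 3 Lc j * (Lc : ℝ) ^ 4))
    (hBb : ∀ (α m : Fin 4) (y : Fin 4 → ℤ) (β : Fin 4) (x : Fin 4 → ℤ) (κ : Fin 4) (u : Fin 4 → ℤ) (κ' : Fin 4) (u' : Fin 4 → ℤ),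
      reflSign α β * reflSign α κ * reflSign α κ' * reflSign α m *
          (vh2KerAt (toSite (ctrOff 4 Lc)) Lc m (bref α m y) (β, bref α β x) (κ, bref α κ u) (κ', bref α κ' u')
            + vh2KerAt (toSite (ctrOff 4 Lc)) Lc m (bref α m y) (β, bref α β x) (κ', bref α κ' u') (κ, bref α κ u))
        = (vh2KerAt (toSite (ctrOff 4 Lc)) Lc m y (β, x) (κ, u) (κ', u') + vh2KerAt (toSite (ctrOff 4 Lc)) Lc m y (β, x) (κ', u') (κ, u))
          + 2 * (vhKerAt (toSite (ctrOff 4 Lc)) Lc m y (β, x) (κ', u')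
                  * ((if m = α then linKerAt (toSite (ctrOff 4 Lc)) Lc m y (κ, u) else 0) - (if x = u ∧ β = κ ∧ κ = α then 1 else 0))
                + vhKerAt (toSite (ctrOff 4 Lc)) Lc m y (β, x) (κ, u)
                  * ((if m = α then linKerAt (toSite (ctrOff 4 Lc)) Lc m y (κ', u') else 0) - (if x = u' ∧ β = κ' ∧ κ' = α then 1 else 0))
                + linKerAt (toSite (ctrOff 4 Lc)) Lc m y (β, x)
                  * ((if m = α then linKerAt (toSite (ctrOff 4 Lc)) Lc m y (κ, u) else 0) - (if x = u ∧ β = κ ∧ κ = α then 1 else 0))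
                  * ((if m = α then linKerAt (toSite (ctrOff 4 Lc)) Lc m y (κ', u') else 0) - (if x = u' ∧ β = κ' ∧ κ' = α then 1 else 0)))) :
    (∀ j : ℕ, WardTransversal (flipK (TbalOf Lc (JsRowD1Pin hLc N) j)))
      ∧ (∀ j : ℕ, AxisReflectionCovariant (flipK (TbalOf Lc (JsRowD1Pin hLc N) j))) :=
  symmetries_JsRowD1Pin_of_borderLaws hLc hN γ hγ hBb siteWardB

open Classical in
/-- [folklore] **BINDER ROW D1 FOR `JsRowD1Pin hLc N` IN BOND CURRENCY WITH THREE OF THE FOUR BOND IDENTITIES DISCHARGED**: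
`D1Drift Lc (JsRowD1Pin hLc N) Nc μ ν` ⟸ `hBb` ∧ `D1Tel Lc (JsRowD1Pin hLc N) Jc` ∧ `D1Rep Lc Jc Nc μ ν a SL k` (+ the route theorem's printed B5 facts,
window, `μ ≠ ν`, `Nc ≠ 0`, `2 ≤ Lc`, `2 ≤ N`) — RX-M4's `d1Drift_JsRowD1Pin_of_borderBondLaw_siteLaws_D1Tel_D1Rep` with `hSB := siteWardB`,
`hSM := siteWardM`.  CONDITIONAL; `Nc` not pinned to `N` ((P6)). -/
theorem d1Drift_JsRowD1Pin_of_borderBondLaw_D1Tel_D1Rep (hLc : Odd Lc) (hL2 : 2 ≤ Lc) {N : ℕ} (hN : 2 ≤ N)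
    (hBb : ∀ (α m : Fin 4) (y : Fin 4 → ℤ) (β : Fin 4) (x : Fin 4 → ℤ) (κ : Fin 4) (u : Fin 4 → ℤ) (κ' : Fin 4) (u' : Fin 4 → ℤ),
      reflSign α β * reflSign α κ * reflSign α κ' * reflSign α m *
          (vh2KerAt (toSite (ctrOff 4 Lc)) Lc m (bref α m y) (β, bref α β x) (κ, bref α κ u) (κ', bref α κ' u')
            + vh2KerAt (toSite (ctrOff 4 Lc)) Lc m (bref α m y) (β, bref α β x) (κ', bref α κ' u') (κ, bref α κ u))
        = (vh2KerAt (toSite (ctrOff 4 Lc)) Lc m y (β, x) (κ, u) (κ', u') + vh2KerAt (toSite (ctrOff 4 Lc)) Lc m y (β, x) (κ', u') (κ, u))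
          + 2 * (vhKerAt (toSite (ctrOff 4 Lc)) Lc m y (β, x) (κ', u')
                  * ((if m = α then linKerAt (toSite (ctrOff 4 Lc)) Lc m y (κ, u) else 0) - (if x = u ∧ β = κ ∧ κ = α then 1 else 0))
                + vhKerAt (toSite (ctrOff 4 Lc)) Lc m y (β, x) (κ, u)
                  * ((if m = α then linKerAt (toSite (ctrOff 4 Lc)) Lc m y (κ', u') else 0) - (if x = u' ∧ β = κ' ∧ κ' = α then 1 else 0))
                + linKerAt (toSite (ctrOff 4 Lc)) Lc m y (β, x)
                  * ((if m = α then linKerAt (toSite (ctrOff 4 Lc)) Lc m y (κ, u) else 0) - (if x = u ∧ β = κ ∧ κ = α then 1 else 0))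
                  * ((if m = α then linKerAt (toSite (ctrOff 4 Lc)) Lc m y (κ', u') else 0) - (if x = u' ∧ β = κ' ∧ κ' = α then 1 else 0))))
    (a : ℝ) (ha : 0 < a)
    (h12 : B5.Prop12Printed (fam (fun i : ℕ+ × ℕ => ((i.1 : ℕ+) : ℕ)) (fun i => i.1.pos) MvE a ha))
    (h126 : B5.Kernel126_127Printed (kfam (fun i : ℕ+ × ℕ => ((i.1 : ℕ+) : ℕ)) MvE))
    {L : Type*} {SL : Finset L} (hSL : SL.Nonempty) (k : L → Fin 4) {μ ν : Fin 4} (hμν : μ ≠ ν) {Nc : ℝ} (hNc : Nc ≠ 0)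
    (Jc : ∀ m : ℕ, JetData 3 (Lc ^ m)) (htel : D1Tel Lc (JsRowD1Pin hLc N) Jc)
    {cc : ℝ} {M : ℕ → ℕ} (hc : 1 ≤ cc) (hMw : ∀ L : ℕ, 2 ≤ L → 1 ≤ M L ∧ (L : ℝ) ≤ cc * M L) (hML : ∀ L : ℕ, 2 ≤ L → M L ≤ L)
    (hrep : D1Rep Lc Jc Nc μ ν a SL k) :
    D1Drift Lc (JsRowD1Pin hLc N) Nc μ ν :=
  d1Drift_JsRowD1Pin_of_borderBondLaw_siteLaws_D1Tel_D1Rep hLc hL2 hN hBb siteWardB siteWardM a ha h12 h126 hSL k hμν hNc Jc htel hc hMw hML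
    hrep

end Row

end Summit.QuantumFields.BalabanUV.Beta.BorderWardSiteLaw
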